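import Mathlib.Analysis.Complex.Polynomial.Basic
import Mathlib.Algebra.Lie.Sl2
import Mathlib.Algebra.Lie.OfAssociative
import Mathlib.LinearAlgebra.Eigenspace.Triangularizable
import Mathlib.Algebra.Lie.Weights.Basic
import Literature.NumberTheory.Automorphic.KugaLemmaDegreeOne
import HarnessLib

/-!
# `K`-types of unitary `(𝔤𝔩₂(ℂ), U(2))`-modules with an integral infinitesimal character:
# the lowest `SU(2)`-type is `V_{p+q}` when `Ω_L = ½(p² − 1) = Ω_R`, and there is none otherwise

The archimedean input of the Eichler–Shimura–Harder isomorphism for Bianchi groups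
[cite: Harder1987, §3.1–3.2], in an ABSTRACT operator form.  A `(𝔤𝔩₂(ℂ)_ℝ, U(2))`-module on which
the two commuting complex-linear `𝔰𝔩₂(ℂ)`-actions `L` (holomorphic) and `R` (anti-holomorphic) of
`GL2ComplexCasimirScalar` (`ρ(Z) = L(Z) + R(Z̄)`) have Casimir scalars `Ω_L = c_L`, `Ω_R = c_R`
(`Ω = ½H² + EF + FE`), and which is unitary (`L(Z)† = −R(Z̄)` for a positive definite Hermitian
form), enters only through the six operators `L(E), L(F), L(H), R(E), R(F), R(H)`.  The compact
`𝔨_ℂ = 𝔰𝔩₂` is the "twisted diagonal" `E_k = L(E) − R(F)`, `F_k = L(F) − R(E)`, `H_k = L(H) − R(H)`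
and `𝔭_ℂ` is spanned by `P₊ = L(E) + R(F)`, `P₋ = L(F) + R(E)`, `P₀ = L(H) + R(H)`
(`(P₊, P₋, H_k)` is a non-compact `𝔰𝔩₂`-triple with `P₊† = −P₋`).

For a `𝔨`-highest-weight vector `w` (`E_k w = 0`, `H_k w = k w`):
* `norm_Pp` — `‖P₊ w‖² = ‖P₋ w‖² + k ‖w‖²` (raising never kills in positive weight, `isHW_Pp`);
* `norm_pSum` — `½‖P₀ w‖² + ‖P₊ w‖² + ‖P₋ w‖² = (½k² + k − 2c_L − 2c_R) ‖w‖²`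
  (`½P₀² + P₊P₋ + P₋P₊ = 2(Ω_L + Ω_R) − Ω_𝔨`);
* `inner_P0_eq` — `(c_L − c_R) ⟪h, w⟫ = ½(k + 2) ⟪h, P₀ w⟫` for highest-weight `h, w` of weight `k`
  (`Ω_L − Ω_R = ½P₀H_k + ½(P₊F_k + E_kP₋ + P₋E_k + F_kP₊)`), whence
  **`eq_zero_of_ne`: if `c_L ≠ c_R` there is no non-zero highest-weight vector** (no unitary module:
  the vanishing of Bianchi cuspidal cohomology for `λ_σ ≠ λ_{σ̄}` up to the centre
  [cite: Harder1987, §3.2]), and for `c_L = c_R`: `‖P₀ w‖² = 4‖P₊ w‖²/(k + 2)`;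
* `isHW_lower`, `norm_lower` — the weight-`(k − 2)` highest-weight component
  `w₋ = P₋ w − k⁻¹ F_k P₀ w − (k(k+1))⁻¹ F_k² P₊ w` of `P₋ w` has
  `‖w₋‖² = k (k² − 8c − 4) ‖w‖² / (4(k + 1))`, `c = c_L = c_R`; for `c = ½(p² − 1)` this is
  `k (k − 2p)(k + 2p) ‖w‖² / (4(k+1))`: negative below `2p`, zero at `2p`, positive above;
* **`exists_isHW_two_mul`** — consequently, if `c_L = c_R = ½(p² − 1)` with `p ≥ 1`, every vector
  lies in a finite-dimensional `𝔨`-stable subspace and no non-zero vector is killed by all six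
  operators, then a non-zero module contains a non-zero `𝔨`-highest-weight vector of weight EXACTLY
  `2p` — the lowest `K`-type `V_{2p}` of the principal series `π(2p, 0)`, the unique unitary
  infinite-dimensional `(𝔤, K)`-module with the infinitesimal character of `Sym^{p−1} ⊗ \overline{Sym}^{p−1}`
  [cite: Harder1987, §3.1 (3.1.3)–(3.1.5)].

Everything is proved from the commutation relations, the two Casimir scalars, adjointness and
positivity; the existence of a highest-weight vector with weight in `ℕ` inside a finite-dimensional
`𝔨`-stable subspace is Mathlib's `IsSl2Triple.exists_hasPrimitiveVectorWith` / `exists_nat`.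
-/

noncomputable section

-- Mathlib idiom (Mathlib/Algebra/Lie/OfAssociative.lean): the commutator bracket on `Module.End`,
-- needed to use Mathlib's `IsSl2Triple` for the restricted `𝔨`-triple.
attribute [local instance 100] LieRing.ofAssociativeRing LieAlgebra.ofAssociativeAlgebra
  LieModule.ofAssociativeModule

open scoped ComplexConjugate
open Finset Module

namespace Literature.NumberTheory.Automorphic

namespace GL2CKType

variable {C : Type*} [AddCommGroup C] [Module ℂ C]

/-! ### The six operators and their relations -/

variable (C) in
/-- Two commuting `𝔰𝔩₂(ℂ)`-triples of operators `(L(H), L(E), L(F))`, `(R(H), R(E), R(F))`: the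
holomorphic and anti-holomorphic parts of a real `𝔤𝔩₂(ℂ)`-module. [cite: Knapp2002, §VI.1] -/
structure Ops where
  /-- `L(E)`. -/
  LE : Module.End ℂ C
  /-- `L(F)`. -/
  LF : Module.End ℂ C
  /-- `L(H)`. -/
  LH : Module.End ℂ C
  /-- `R(E)`. -/
  RE : Module.End ℂ C
  /-- `R(F)`. -/
  RF : Module.End ℂ C
  /-- `R(H)`. -/
  RH : Module.End ℂ C

namespace Ops

variable (O : Ops C)

/-- The `𝔰𝔩₂` relations `[H, E] = 2E`, `[H, F] = −2F`, `[E, F] = H` for `L` and for `R`, and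
`[L, R] = 0`, written as oriented rewrite rules. [cite: Knapp2002, §VI.1] -/
structure IsLawful : Prop where
  lhe : ∀ v, O.LH (O.LE v) = O.LE (O.LH v) + (2 : ℂ) • O.LE v
  lhf : ∀ v, O.LH (O.LF v) = O.LF (O.LH v) - (2 : ℂ) • O.LF v
  lef : ∀ v, O.LE (O.LF v) = O.LF (O.LE v) + O.LH v
  rhe : ∀ v, O.RH (O.RE v) = O.RE (O.RH v) + (2 : ℂ) • O.RE v
  rhf : ∀ v, O.RH (O.RF v) = O.RF (O.RH v) - (2 : ℂ) • O.RF v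
  ref : ∀ v, O.RE (O.RF v) = O.RF (O.RE v) + O.RH v
  cEE : ∀ v, O.RE (O.LE v) = O.LE (O.RE v)
  cEF : ∀ v, O.RE (O.LF v) = O.LF (O.RE v)
  cEH : ∀ v, O.RE (O.LH v) = O.LH (O.RE v)
  cFE : ∀ v, O.RF (O.LE v) = O.LE (O.RF v)
  cFF : ∀ v, O.RF (O.LF v) = O.LF (O.RF v)
  cFH : ∀ v, O.RF (O.LH v) = O.LH (O.RF v)
  cHE : ∀ v, O.RH (O.LE v) = O.LE (O.RH v)
  cHF : ∀ v, O.RH (O.LF v) = O.LF (O.RH v)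
  cHH : ∀ v, O.RH (O.LH v) = O.LH (O.RH v)

/-- `E_k = L(E) − R(F)`: the raising operator of `𝔨_ℂ = 𝔰𝔩₂` (`𝔲(2) ∋ Y ↦ L(Y) − R(Yᵀ)`).
[cite: Knapp2002, §VI.1] -/
def Ek : Module.End ℂ C := O.LE - O.RF
/-- `F_k = L(F) − R(E)`. [cite: Knapp2002, §VI.1] -/
def Fk : Module.End ℂ C := O.LF - O.RE
/-- `H_k = L(H) − R(H)`. [cite: Knapp2002, §VI.1] -/
def Hk : Module.End ℂ C := O.LH - O.RH
/-- `P₊ = L(E) + R(F)`: the highest-weight vector of `𝔭_ℂ ≅ V₂` (`𝔭 ∋ X ↦ L(X) + R(Xᵀ)`).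
[cite: Knapp2002, §VI.1] -/
def Pp : Module.End ℂ C := O.LE + O.RF
/-- `P₋ = L(F) + R(E)`. [cite: Knapp2002, §VI.1] -/
def Pm : Module.End ℂ C := O.LF + O.RE
/-- `P₀ = L(H) + R(H)`. [cite: Knapp2002, §VI.1] -/
def P0 : Module.End ℂ C := O.LH + O.RH

/-- Unfolding. [folklore] -/
@[simp] theorem Ek_apply (v : C) : O.Ek v = O.LE v - O.RF v := rfl
/-- Unfolding. [folklore] -/
@[simp] theorem Fk_apply (v : C) : O.Fk v = O.LF v - O.RE v := rfl
/-- Unfolding. [folklore] -/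
@[simp] theorem Hk_apply (v : C) : O.Hk v = O.LH v - O.RH v := rfl
/-- Unfolding. [folklore] -/
@[simp] theorem Pp_apply (v : C) : O.Pp v = O.LE v + O.RF v := rfl
/-- Unfolding. [folklore] -/
@[simp] theorem Pm_apply (v : C) : O.Pm v = O.LF v + O.RE v := rfl
/-- Unfolding. [folklore] -/
@[simp] theorem P0_apply (v : C) : O.P0 v = O.LH v + O.RH v := rfl

variable {O}

section Brackets

variable (hO : O.IsLawful)
include hO

/-- `[E_k, P₊] = 0`. [folklore] -/
theorem Ek_Pp (v : C) : O.Ek (O.Pp v) = O.Pp (O.Ek v) := by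
  simp only [Ek_apply, Pp_apply, map_add, map_sub, hO.cFE]
  module

/-- `[H_k, P₊] = 2P₊`. [folklore] -/
theorem Hk_Pp (v : C) : O.Hk (O.Pp v) = O.Pp (O.Hk v) + (2 : ℂ) • O.Pp v := by
  simp only [Hk_apply, Pp_apply, map_add, map_sub, smul_add, hO.lhe, hO.rhf, hO.cFH, hO.cHE]
  module

/-- `[H_k, P₋] = −2P₋`. [folklore] -/
theorem Hk_Pm (v : C) : O.Hk (O.Pm v) = O.Pm (O.Hk v) - (2 : ℂ) • O.Pm v := by
  simp only [Hk_apply, Pm_apply, map_add, map_sub, smul_add, hO.lhf, hO.rhe, hO.cEH, hO.cHF]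
  module

/-- `[P₊, P₋] = H_k`. [folklore] -/
theorem Pp_Pm (v : C) : O.Pp (O.Pm v) = O.Pm (O.Pp v) + O.Hk v := by
  simp only [Hk_apply, Pp_apply, Pm_apply, map_add, hO.lef, hO.ref, hO.cEE, hO.cFF]
  module

/-- `[E_k, P₋] = P₀`. [folklore] -/
theorem Ek_Pm (v : C) : O.Ek (O.Pm v) = O.Pm (O.Ek v) + O.P0 v := by
  simp only [Ek_apply, Pm_apply, P0_apply, map_add, map_sub, hO.lef, hO.ref, hO.cEE, hO.cFF]
  module

/-- `[E_k, P₀] = −2P₊`. [folklore] -/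
theorem Ek_P0 (v : C) : O.Ek (O.P0 v) = O.P0 (O.Ek v) - (2 : ℂ) • O.Pp v := by
  simp only [Ek_apply, Pp_apply, P0_apply, map_add, map_sub, smul_add, hO.lhe, hO.rhf, hO.cFH,
    hO.cHE]
  module

/-- `[F_k, P₊] = −P₀`. [folklore] -/
theorem Fk_Pp (v : C) : O.Fk (O.Pp v) = O.Pp (O.Fk v) - O.P0 v := by
  simp only [Fk_apply, Pp_apply, P0_apply, map_add, map_sub, hO.lef, hO.ref, hO.cEE, hO.cFF]
  module

/-- `[H_k, P₀] = 0`. [folklore] -/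
theorem Hk_P0 (v : C) : O.Hk (O.P0 v) = O.P0 (O.Hk v) := by
  simp only [Hk_apply, P0_apply, map_add, map_sub, hO.cHH]
  module

/-- `[H_k, E_k] = 2E_k`. [folklore] -/
theorem Hk_Ek (v : C) : O.Hk (O.Ek v) = O.Ek (O.Hk v) + (2 : ℂ) • O.Ek v := by
  simp only [Ek_apply, Hk_apply, map_sub, smul_sub, hO.lhe, hO.rhf, hO.cFH, hO.cHE]
  module

/-- `[H_k, F_k] = −2F_k`. [folklore] -/
theorem Hk_Fk (v : C) : O.Hk (O.Fk v) = O.Fk (O.Hk v) - (2 : ℂ) • O.Fk v := by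
  simp only [Fk_apply, Hk_apply, map_sub, smul_sub, hO.lhf, hO.rhe, hO.cEH, hO.cHF]
  module

/-- `[E_k, F_k] = H_k`. [folklore] -/
theorem Ek_Fk (v : C) : O.Ek (O.Fk v) = O.Fk (O.Ek v) + O.Hk v := by
  simp only [Ek_apply, Fk_apply, Hk_apply, map_sub, hO.lef, hO.ref, hO.cEE, hO.cFF]
  module

/-- `[P₀, P₊] = 2E_k`. [folklore] -/
theorem P0_Pp (v : C) : O.P0 (O.Pp v) = O.Pp (O.P0 v) + (2 : ℂ) • O.Ek v := by
  simp only [Ek_apply, Pp_apply, P0_apply, map_add, smul_sub, hO.lhe, hO.rhf, hO.cFH, hO.cHE]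
  module

end Brackets

/-! ### Casimir operators and the two key identities -/

variable (O) in
/-- `Ω_L = ½ L(H)² + L(E)L(F) + L(F)L(E)`, the Casimir operator of the holomorphic `𝔰𝔩₂`.
[cite: Knapp2002, §V.4] -/
def casL : Module.End ℂ C := (2 : ℂ)⁻¹ • (O.LH * O.LH) + O.LE * O.LF + O.LF * O.LE

variable (O) in
/-- `Ω_R = ½ R(H)² + R(E)R(F) + R(F)R(E)`. [cite: Knapp2002, §V.4] -/
def casR : Module.End ℂ C := (2 : ℂ)⁻¹ • (O.RH * O.RH) + O.RE * O.RF + O.RF * O.RE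

/-- Unfolding. [folklore] -/
@[simp] theorem casL_apply (v : C) :
    O.casL v = (2 : ℂ)⁻¹ • O.LH (O.LH v) + O.LE (O.LF v) + O.LF (O.LE v) := rfl

/-- Unfolding. [folklore] -/
@[simp] theorem casR_apply (v : C) :
    O.casR v = (2 : ℂ)⁻¹ • O.RH (O.RH v) + O.RE (O.RF v) + O.RF (O.RE v) := rfl

section Casimir

variable (hO : O.IsLawful)
include hO

/-- **`½P₀² + P₊P₋ + P₋P₊ = 2(Ω_L + Ω_R) − Ω_𝔨`**, `Ω_𝔨 = ½H_k² + E_kF_k + F_kE_k`: the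
`𝔭`-part of the Casimir against the two factor Casimirs. [cite: Harder1987, §3.1] -/
theorem pCasimir_eq (v : C) :
    (2 : ℂ)⁻¹ • O.P0 (O.P0 v) + O.Pp (O.Pm v) + O.Pm (O.Pp v) =
      (2 : ℂ) • (O.casL v + O.casR v) -
        ((2 : ℂ)⁻¹ • O.Hk (O.Hk v) + O.Ek (O.Fk v) + O.Fk (O.Ek v)) := by
  simp only [casL_apply, casR_apply, Ek_apply, Fk_apply, Hk_apply, Pp_apply, Pm_apply, P0_apply,
    map_add, map_sub, smul_add, smul_sub, smul_smul, hO.lef, hO.ref, hO.cEE, hO.cFF, hO.cHH]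
  module

/-- **`Ω_L − Ω_R = ½P₀H_k + ½(P₊F_k + E_kP₋ + P₋E_k + F_kP₊)`**. [cite: Harder1987, §3.1] -/
theorem casL_sub_casR_eq (v : C) :
    O.casL v - O.casR v =
      (2 : ℂ)⁻¹ • O.P0 (O.Hk v) +
        (2 : ℂ)⁻¹ • (O.Pp (O.Fk v) + O.Ek (O.Pm v) + O.Pm (O.Ek v) + O.Fk (O.Pp v)) := by
  simp only [casL_apply, casR_apply, Ek_apply, Fk_apply, Hk_apply, Pp_apply, Pm_apply, P0_apply,
    map_add, map_sub, smul_add, smul_sub, hO.lef, hO.ref, hO.cEE, hO.cFF, hO.cHH]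
  module

end Casimir

/-! ### Highest-weight vectors for `𝔨` -/

variable (O) in
/-- `w` is a `𝔨`-highest-weight vector of weight `k`: `E_k w = 0`, `H_k w = k w` (no non-vanishing
is required). [folklore] -/
structure IsHW (w : C) (k : ℂ) : Prop where
  ek : O.Ek w = 0
  hk : O.Hk w = k • w

section HW

variable (hO : O.IsLawful)
include hO

/-- **Raising**: `P₊` maps highest-weight vectors of weight `k` to highest-weight vectors of weight
`k + 2`. [cite: Harder1987, §3.1] -/
theorem isHW_Pp {w : C} {k : ℂ} (hw : O.IsHW w k) : O.IsHW (O.Pp w) (k + 2) := by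
  refine ⟨?_, ?_⟩
  · rw [Ek_Pp hO, hw.ek, map_zero]
  · rw [Hk_Pp hO, hw.hk, map_smul, add_smul]

/-- `Ω_𝔨 w = (½k² + k) w` on a highest-weight vector. [folklore] -/
theorem kCasimir_apply {w : C} {k : ℂ} (hw : O.IsHW w k) :
    (2 : ℂ)⁻¹ • O.Hk (O.Hk w) + O.Ek (O.Fk w) + O.Fk (O.Ek w) = ((2 : ℂ)⁻¹ * k ^ 2 + k) • w := by
  rw [Ek_Fk hO, hw.ek, map_zero, hw.hk, map_smul, hw.hk, smul_smul, zero_add, add_zero, sq]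
  module

/-- `E_k P₋ w = P₀ w` on a highest-weight vector. [folklore] -/
theorem Ek_Pm_apply {w : C} {k : ℂ} (hw : O.IsHW w k) : O.Ek (O.Pm w) = O.P0 w := by
  rw [Ek_Pm hO, hw.ek, map_zero, zero_add]

/-- `E_k P₀ w = −2 P₊ w` on a highest-weight vector. [folklore] -/
theorem Ek_P0_apply {w : C} {k : ℂ} (hw : O.IsHW w k) : O.Ek (O.P0 w) = -((2 : ℂ) • O.Pp w) := by
  rw [Ek_P0 hO, hw.ek, map_zero, zero_sub]

/-- `E_k F_k (P₊ w) = (k + 2) P₊ w`. [folklore] -/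
theorem Ek_Fk_Pp_apply {w : C} {k : ℂ} (hw : O.IsHW w k) :
    O.Ek (O.Fk (O.Pp w)) = (k + 2) • O.Pp w := by
  have h := isHW_Pp hO hw
  rw [Ek_Fk hO, h.ek, map_zero, zero_add, h.hk]

/-- `E_k F_k (P₀ w) = k P₀ w − 2 F_k P₊ w`. [folklore] -/
theorem Ek_Fk_P0_apply {w : C} {k : ℂ} (hw : O.IsHW w k) :
    O.Ek (O.Fk (O.P0 w)) = k • O.P0 w - (2 : ℂ) • O.Fk (O.Pp w) := by
  rw [Ek_Fk hO, Ek_P0_apply hO hw, map_neg, map_smul, Hk_P0 hO, hw.hk, map_smul]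
  abel

/-- `E_k F_k² (P₊ w) = (2k + 2) F_k P₊ w`. [folklore] -/
theorem Ek_Fk_Fk_Pp_apply {w : C} {k : ℂ} (hw : O.IsHW w k) :
    O.Ek (O.Fk (O.Fk (O.Pp w))) = (2 * k + 2) • O.Fk (O.Pp w) := by
  have h := isHW_Pp hO hw
  rw [Ek_Fk hO, Ek_Fk_Pp_apply hO hw, map_smul, Hk_Fk hO, h.hk, map_smul]
  module

variable (O) in
/-- **The lowering vector** `w₋ = P₋ w − k⁻¹ F_k P₀ w − (k(k+1))⁻¹ F_k² P₊ w`: the highest-weight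
component of weight `k − 2` of `P₋ w ∈ 𝔭_ℂ ⊗ w ≅ V₂ ⊗ V_k`. [cite: Harder1987, §3.1] -/
def lower (w : C) (k : ℂ) : C :=
  O.Pm w - k⁻¹ • O.Fk (O.P0 w) - (k * (k + 1))⁻¹ • O.Fk (O.Fk (O.Pp w))

/-- `w₋` is a highest-weight vector of weight `k − 2` (for `k ≠ 0, −1`). [cite: Harder1987, §3.1] -/
theorem isHW_lower {w : C} {k : ℂ} (hw : O.IsHW w k) (hk0 : k ≠ 0) (hk1 : k + 1 ≠ 0) :
    O.IsHW (O.lower w k) (k - 2) := by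
  refine ⟨?_, ?_⟩
  · simp only [lower, map_sub, map_smul, Ek_Pm_apply hO hw, Ek_Fk_P0_apply hO hw,
    Ek_Fk_Fk_Pp_apply hO hw, smul_sub, smul_smul]
    rw [inv_mul_cancel₀ hk0, one_smul, show (k * (k + 1))⁻¹ * (2 * k + 2) = k⁻¹ * 2 by
      field_simp]
    module
  · have h := isHW_Pp hO hw
    simp only [lower, map_sub, map_smul, Hk_Pm hO, hw.hk, map_smul, Hk_Fk hO, Hk_P0 hO, h.hk,
    smul_sub, smul_smul]
    module

end HW

/-! ### Unitarity: adjoints and norms -/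

section Unitary

variable {ip : C → C → ℂ} (hip : Kuga.IsPosForm ip) (hO : O.IsLawful)
  (hE : ∀ x y, ip (O.LE x) y = -ip x (O.RE y))
  (hF : ∀ x y, ip (O.LF x) y = -ip x (O.RF y))
  (hH : ∀ x y, ip (O.LH x) y = -ip x (O.RH y))
include hip

section Adjoints
include hE in
/-- `R(E)† = −L(E)`. [folklore] -/
theorem adj_RE (x y : C) : ip (O.RE x) y = -ip x (O.LE y) := by
  have h' : ip y (O.RE x) = -ip (O.LE y) x := by rw [hE]; ring
  calc ip (O.RE x) y = conj (ip y (O.RE x)) := (hip.conj_symm _ _).symm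
    _ = -conj (ip (O.LE y) x) := by rw [h', map_neg]
    _ = -ip x (O.LE y) := by rw [hip.conj_symm]

include hF in
/-- `R(F)† = −L(F)`. [folklore] -/
theorem adj_RF (x y : C) : ip (O.RF x) y = -ip x (O.LF y) := by
  have h' : ip y (O.RF x) = -ip (O.LF y) x := by rw [hF]; ring
  calc ip (O.RF x) y = conj (ip y (O.RF x)) := (hip.conj_symm _ _).symm
    _ = -conj (ip (O.LF y) x) := by rw [h', map_neg]
    _ = -ip x (O.LF y) := by rw [hip.conj_symm]

include hH in
/-- `R(H)† = −L(H)`. [folklore] -/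
theorem adj_RH (x y : C) : ip (O.RH x) y = -ip x (O.LH y) := by
  have h' : ip y (O.RH x) = -ip (O.LH y) x := by rw [hH]; ring
  calc ip (O.RH x) y = conj (ip y (O.RH x)) := (hip.conj_symm _ _).symm
    _ = -conj (ip (O.LH y) x) := by rw [h', map_neg]
    _ = -ip x (O.LH y) := by rw [hip.conj_symm]

include hE hF in
/-- `P₊† = −P₋`. [cite: Harder1987, §3.1] -/
theorem adj_Pp (x y : C) : ip (O.Pp x) y = -ip x (O.Pm y) := by
  rw [Pp_apply, Pm_apply, hip.add_left, hip.add_right, hE, adj_RF hip hF]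
  ring

include hE hF in
/-- `P₋† = −P₊`. [cite: Harder1987, §3.1] -/
theorem adj_Pm (x y : C) : ip (O.Pm x) y = -ip x (O.Pp y) := by
  rw [Pp_apply, Pm_apply, hip.add_left, hip.add_right, hF, adj_RE hip hE]
  ring

include hH in
/-- `P₀† = −P₀`. [folklore] -/
theorem adj_P0 (x y : C) : ip (O.P0 x) y = -ip x (O.P0 y) := by
  rw [P0_apply, P0_apply, hip.add_left, hip.add_right, hH, adj_RH hip hH]
  ring

include hE hF in
/-- `E_k† = F_k`. [folklore] -/
theorem adj_Ek (x y : C) : ip (O.Ek x) y = ip x (O.Fk y) := by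
  rw [Ek_apply, Fk_apply, hip.sub_left, hip.sub_right, hE, adj_RF hip hF]
  ring

include hE hF in
/-- `F_k† = E_k`. [folklore] -/
theorem adj_Fk (x y : C) : ip (O.Fk x) y = ip x (O.Ek y) := by
  rw [Ek_apply, Fk_apply, hip.sub_left, hip.sub_right, hF, adj_RE hip hE]
  ring

end Adjoints

include hO hE hF in
/-- **Raising never kills in positive weight**: `‖P₊ w‖² = ‖P₋ w‖² + k ‖w‖²` for a highest-weight
vector of weight `k` (`[P₊, P₋] = H_k`, `P₊† = −P₋`). [cite: Harder1987, §3.1] -/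
theorem inner_Pp_Pp {w : C} {k : ℂ} (hw : O.IsHW w k) :
    ip (O.Pp w) (O.Pp w) = ip (O.Pm w) (O.Pm w) + k * ip w w := by
  have h1 : ip (O.Pp w) (O.Pp w) = -ip w (O.Pm (O.Pp w)) := adj_Pp hip hE hF _ _
  have h2 : ip (O.Pm w) (O.Pm w) = -ip w (O.Pp (O.Pm w)) := adj_Pm hip hE hF _ _
  rw [h1, h2, Pp_Pm hO, hip.add_right, hw.hk, hip.smul_right]
  ring

include hO hE hF hH in
/-- **The `𝔭`-Casimir norm identity**:
`½⟪P₀w, P₀w⟫ + ⟪P₊w, P₊w⟫ + ⟪P₋w, P₋w⟫ = (½k² + k − 2c_L − 2c_R) ⟪w, w⟫` for a highest-weight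
vector of weight `k` when `Ω_L = c_L`, `Ω_R = c_R`. [cite: Harder1987, §3.1] -/
theorem inner_pSum {cL cR : ℂ} (hcL : ∀ v, O.casL v = cL • v) (hcR : ∀ v, O.casR v = cR • v)
    {w : C} {k : ℂ} (hw : O.IsHW w k) :
    (2 : ℂ)⁻¹ * ip (O.P0 w) (O.P0 w) + ip (O.Pp w) (O.Pp w) + ip (O.Pm w) (O.Pm w) =
      ((2 : ℂ)⁻¹ * k ^ 2 + k - 2 * cL - 2 * cR) * ip w w := by
  have key := congrArg (ip w) (pCasimir_eq hO w)
  rw [kCasimir_apply hO hw, hcL, hcR, hip.add_right, hip.add_right, hip.smul_right,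
    hip.sub_right, hip.smul_right, hip.add_right, hip.smul_right, hip.smul_right,
    hip.smul_right] at key
  have h0 : ip w (O.P0 (O.P0 w)) = -ip (O.P0 w) (O.P0 w) := by rw [adj_P0 hip hH, neg_neg]
  have hp : ip w (O.Pp (O.Pm w)) = -ip (O.Pm w) (O.Pm w) := by rw [adj_Pm hip hE hF, neg_neg]
  have hm : ip w (O.Pm (O.Pp w)) = -ip (O.Pp w) (O.Pp w) := by rw [adj_Pp hip hE hF, neg_neg]
  rw [h0, hp, hm] at key
  linear_combination -key

include hO hE hF hH in
/-- **The mixed identity**: `(c_L − c_R) ⟪h, w⟫ = ½(k + 2) ⟪h, P₀ w⟫` for highest-weight vectors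
`h, w` of the same weight `k`. [cite: Harder1987, §3.1] -/
theorem inner_P0_eq {cL cR : ℂ} (hcL : ∀ v, O.casL v = cL • v) (hcR : ∀ v, O.casR v = cR • v)
    {h w : C} {k : ℂ} (hh : O.IsHW h k) (hw : O.IsHW w k) :
    (cL - cR) * ip h w = (2 : ℂ)⁻¹ * (k + 2) * ip h (O.P0 w) := by
  have key := congrArg (ip h) (casL_sub_casR_eq hO w)
  rw [hcL, hcR, ← sub_smul, hip.smul_right, hip.add_right, hip.smul_right, hip.smul_right,
    hw.hk, map_smul, hip.smul_right, hip.add_right, hip.add_right, hip.add_right, hw.ek, map_zero,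
    hip.zero_right, add_zero] at key
  -- `⟪h, P₊ F_k w⟫ = ⟪h, P₀ w⟫`
  have h1 : ip h (O.Pp (O.Fk w)) = ip h (O.P0 w) := by
    rw [← neg_neg (ip h (O.Pp (O.Fk w))), ← adj_Pm hip hE hF, ← adj_Ek hip hE hF,
      Ek_Pm_apply hO hh, adj_P0 hip hH, neg_neg]
  -- `⟪h, E_k P₋ w⟫ = ⟪h, P₀ w⟫`
  have h2 : ip h (O.Ek (O.Pm w)) = ip h (O.P0 w) := by rw [Ek_Pm_apply hO hw]
  -- `⟪h, F_k P₊ w⟫ = 0`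
  have h3 : ip h (O.Fk (O.Pp w)) = 0 := by rw [← adj_Ek hip hE hF, hh.ek, hip.zero_left]
  rw [h1, h2, h3] at key
  linear_combination key

include hO hE hF hH in
/-- **No highest-weight vectors when `c_L ≠ c_R`** (`k` real): the module is zero — the unitary dual
of `SL₂(ℂ)` has nothing with the infinitesimal character of `Sym^m ⊗ \overline{Sym}^n`, `m ≠ n`
(vanishing of Bianchi cuspidal cohomology off the "parallel" weights). [cite: Harder1987, §3.2] -/
theorem eq_zero_of_casimir_ne {cL cR : ℝ} (hne : cL ≠ cR) (hcL : ∀ v, O.casL v = (cL : ℂ) • v)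
    (hcR : ∀ v, O.casR v = (cR : ℂ) • v) {w : C} {k : ℝ} (hw : O.IsHW w (k : ℂ)) : w = 0 := by
  have key := inner_P0_eq hip hO hE hF hH hcL hcR hw hw
  -- `⟪w, P₀ w⟫` is purely imaginary, `⟪w, w⟫` real
  have him : (ip w (O.P0 w)).re = 0 := by
    have e : ip w (O.P0 w) = -conj (ip w (O.P0 w)) := by
      rw [hip.conj_symm, adj_P0 hip hH, neg_neg]
    have := congrArg Complex.re e
    simp only [Complex.neg_re, Complex.conj_re] at this
    linarith
  have hre := congrArg Complex.re key
  simp only [Complex.mul_re, Complex.sub_re, Complex.ofReal_re, Complex.sub_im, Complex.ofReal_im,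
    sub_self, zero_mul, sub_zero, him, mul_zero] at hre
  have hwim : (ip w w).im = 0 := hip.self_im w
  have h2 : ((2 : ℂ)⁻¹ * ((k : ℂ) + 2)).im = 0 := by simp
  rw [h2, zero_mul, sub_zero] at hre
  -- `(cL - cR) * re ⟪w, w⟫ = 0`
  have : (ip w w).re = 0 := by
    rcases mul_eq_zero.1 hre with h | h
    · exact absurd (sub_eq_zero.1 h) hne
    · exact h
  exact hip.eq_zero_of_re_self_eq_zero this

include hO hE hF hH in
/-- For `c_L = c_R`: `⟪h, P₀ w⟫ = 0` for highest-weight `h, w` of weight `k ≠ −2`. [folklore] -/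
theorem inner_P0_eq_zero {c : ℂ} (hcL : ∀ v, O.casL v = c • v) (hcR : ∀ v, O.casR v = c • v)
    {h w : C} {k : ℂ} (hh : O.IsHW h k) (hw : O.IsHW w k) (hk : k + 2 ≠ 0) :
    ip h (O.P0 w) = 0 := by
  have key := inner_P0_eq hip hO hE hF hH hcL hcR hh hw
  rw [sub_self, zero_mul] at key
  have h2 : (2 : ℂ)⁻¹ * (k + 2) ≠ 0 := mul_ne_zero (inv_ne_zero two_ne_zero) hk
  exact (mul_eq_zero.1 key.symm).resolve_left h2

include hO hE hF hH in
/-- For `c_L = c_R`: **`P₀ w = −(2/(k+2)) F_k P₊ w`** on a highest-weight vector of weight `k ≠ −2`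
(the weight-`k` component `u₀ = P₀ w + (2/(k+2)) F_k P₊ w` of `P₀ w` is highest-weight and
orthogonal to all highest-weight vectors of weight `k`, hence zero). [cite: Harder1987, §3.1] -/
theorem P0_eq {c : ℂ} (hcL : ∀ v, O.casL v = c • v) (hcR : ∀ v, O.casR v = c • v)
    {w : C} {k : ℂ} (hw : O.IsHW w k) (hk : k + 2 ≠ 0) :
    O.P0 w = -((2 * (k + 2)⁻¹) • O.Fk (O.Pp w)) := by
  set u : C := O.P0 w + (2 * (k + 2)⁻¹) • O.Fk (O.Pp w) with hu
  have huHW : O.IsHW u k := by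
    refine ⟨?_, ?_⟩
    · rw [hu, map_add, map_smul, Ek_P0_apply hO hw, Ek_Fk_Pp_apply hO hw, smul_smul,
        mul_assoc, inv_mul_cancel₀ hk, mul_one, neg_add_eq_zero]
    · have h := isHW_Pp hO hw
      rw [hu, map_add, map_smul, Hk_P0 hO, hw.hk, map_smul, Hk_Fk hO, h.hk, map_smul, smul_add]
      module
  have h0 : ip u u = 0 := by
    conv_lhs => rw [hu]
    rw [hip.add_right, hip.smul_right, inner_P0_eq_zero hip hO hE hF hH hcL hcR huHW hw hk,
      ← adj_Ek hip hE hF, huHW.ek, hip.zero_left, mul_zero, add_zero]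
  have hu0 : u = 0 := hip.definite u h0
  rw [hu] at hu0
  exact eq_neg_of_add_eq_zero_left hu0

include hO hE hF hH in
/-- For `c_L = c_R`: `⟪P₀ w, P₀ w⟫ = 4 ⟪P₊ w, P₊ w⟫ / (k + 2)` (`k` real, `k ≠ −2`).
[cite: Harder1987, §3.1] -/
theorem inner_P0_P0 {c : ℂ} (hcL : ∀ v, O.casL v = c • v) (hcR : ∀ v, O.casR v = c • v)
    {w : C} {k : ℝ} (hw : O.IsHW w (k : ℂ)) (hk : (k : ℂ) + 2 ≠ 0) :
    ip (O.P0 w) (O.P0 w) = 4 * ((k : ℂ) + 2)⁻¹ * ip (O.Pp w) (O.Pp w) := by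
  have hP := P0_eq hip hO hE hF hH hcL hcR hw hk
  have hFF : ip (O.Fk (O.Pp w)) (O.Fk (O.Pp w)) = ((k : ℂ) + 2) * ip (O.Pp w) (O.Pp w) := by
    rw [adj_Fk hip hE hF, Ek_Fk_Pp_apply hO hw, hip.smul_right]
  rw [hP, hip.neg_left, hip.neg_right, neg_neg, hip.smul_left, hip.smul_right, hFF]
  have hr : conj ((2 : ℂ) * ((k : ℂ) + 2)⁻¹) = 2 * ((k : ℂ) + 2)⁻¹ := by
    rw [show (2 : ℂ) * ((k : ℂ) + 2)⁻¹ = ((2 * (k + 2)⁻¹ : ℝ) : ℂ) by push_cast; ring,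
      Complex.conj_ofReal]
  rw [hr]
  field_simp
  ring

include hO hE hF in
/-- **The norm of the lowering vector**:
`⟪w₋, w₋⟫ = ⟪P₋w, P₋w⟫ − k⁻¹ ⟪P₀w, P₀w⟫ + 2(k(k+1))⁻¹ ⟪P₊w, P₊w⟫` (`k` real, `k ≠ 0, −1`).
[cite: Harder1987, §3.1] -/
theorem inner_lower {w : C} {k : ℝ} (hw : O.IsHW w (k : ℂ)) (hk0 : (k : ℂ) ≠ 0)
    (hk1 : (k : ℂ) + 1 ≠ 0) :
    ip (O.lower w k) (O.lower w k) =
      ip (O.Pm w) (O.Pm w) - (k : ℂ)⁻¹ * ip (O.P0 w) (O.P0 w) +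
        2 * ((k : ℂ) * ((k : ℂ) + 1))⁻¹ * ip (O.Pp w) (O.Pp w) := by
  have hl := isHW_lower hO hw hk0 hk1
  -- `⟪w₋, F_k x⟫ = 0`
  have horth : ∀ x, ip (O.lower w k) (O.Fk x) = 0 := fun x => by
    rw [← adj_Ek hip hE hF, hl.ek, hip.zero_left]
  have h1 : ip (O.lower w k) (O.lower w k) = ip (O.lower w k) (O.Pm w) := by
    show ip (O.lower w k) (O.Pm w - (k : ℂ)⁻¹ • O.Fk (O.P0 w) -
      ((k : ℂ) * ((k : ℂ) + 1))⁻¹ • O.Fk (O.Fk (O.Pp w))) = _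
    rw [hip.sub_right, hip.sub_right, hip.smul_right, hip.smul_right, horth, horth, mul_zero,
      mul_zero, sub_zero, sub_zero]
  rw [h1]
  show ip (O.Pm w - (k : ℂ)⁻¹ • O.Fk (O.P0 w) -
      ((k : ℂ) * ((k : ℂ) + 1))⁻¹ • O.Fk (O.Fk (O.Pp w))) (O.Pm w) = _
  rw [hip.sub_left, hip.sub_left, hip.smul_left, hip.smul_left]
  -- `⟪F_k P₀ w, P₋ w⟫ = ⟪P₀ w, P₀ w⟫`
  have h2 : ip (O.Fk (O.P0 w)) (O.Pm w) = ip (O.P0 w) (O.P0 w) := by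
    rw [adj_Fk hip hE hF, Ek_Pm_apply hO hw]
  -- `⟪F_k² P₊ w, P₋ w⟫ = -2 ⟪P₊ w, P₊ w⟫`
  have h3 : ip (O.Fk (O.Fk (O.Pp w))) (O.Pm w) = -(2 * ip (O.Pp w) (O.Pp w)) := by
    rw [adj_Fk hip hE hF, adj_Fk hip hE hF, Ek_Pm_apply hO hw, Ek_P0_apply hO hw, hip.neg_right,
      hip.smul_right]
  rw [h2, h3]
  have hc1 : conj ((k : ℂ)⁻¹) = (k : ℂ)⁻¹ := by rw [map_inv₀, Complex.conj_ofReal]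
  have hc2 : conj (((k : ℂ) * ((k : ℂ) + 1))⁻¹) = ((k : ℂ) * ((k : ℂ) + 1))⁻¹ := by
    rw [map_inv₀, map_mul, map_add, map_one, Complex.conj_ofReal]
  rw [hc1, hc2]
  ring

include hO hE hF hH in
/-- **The norm of the lowering vector** (for `c_L = c_R = c` real, `k` real, `k ≠ 0, −1, −2`):
`4(k+1) ⟪w₋, w₋⟫ = k (k² − 8c − 4) ⟪w, w⟫`; for `c = ½(p² − 1)` the right-hand side is
`k (k − 2p)(k + 2p) ⟪w, w⟫`. [cite: Harder1987, §3.1] -/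
theorem inner_lower_eq {c : ℝ} (hcL : ∀ v, O.casL v = (c : ℂ) • v)
    (hcR : ∀ v, O.casR v = (c : ℂ) • v) {w : C} {k : ℝ} (hw : O.IsHW w (k : ℂ))
    (hk0 : (k : ℂ) ≠ 0) (hk1 : (k : ℂ) + 1 ≠ 0) (hk2 : (k : ℂ) + 2 ≠ 0) :
    4 * ((k : ℂ) + 1) * ip (O.lower w k) (O.lower w k) =
      (k : ℂ) * ((k : ℂ) ^ 2 - 8 * c - 4) * ip w w := by
  have E1 := inner_Pp_Pp hip hO hE hF hw
  have E2 := inner_pSum hip hO hE hF hH hcL hcR hw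
  have E3 := inner_P0_P0 hip hO hE hF hH hcL hcR hw hk2
  have E4 := inner_lower hip hO hE hF hw hk0 hk1
  have E3' : ((k : ℂ) + 2) * ip (O.P0 w) (O.P0 w) = 4 * ip (O.Pp w) (O.Pp w) := by
    rw [E3]; field_simp
  have E4' : (k : ℂ) * ((k : ℂ) + 1) * ip (O.lower w k) (O.lower w k) =
      (k : ℂ) * ((k : ℂ) + 1) * ip (O.Pm w) (O.Pm w) - ((k : ℂ) + 1) * ip (O.P0 w) (O.P0 w) +
        2 * ip (O.Pp w) (O.Pp w) := by
    rw [E4]; field_simp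
  have goalk : (k : ℂ) * (4 * ((k : ℂ) + 1) * ip (O.lower w k) (O.lower w k)) =
      (k : ℂ) * ((k : ℂ) * ((k : ℂ) ^ 2 - 8 * c - 4) * ip w w) := by
    linear_combination (-2 * (k : ℂ) ^ 2 - 4 * k) * E1 - ((k : ℂ) + 2) * E3' +
      2 * (k : ℂ) ^ 2 * E2 + 4 * E4'
  exact mul_left_cancel₀ hk0 goalk

end Unitary

/-! ### Existence of highest-weight vectors with natural weight (`𝔨`-finiteness) -/

section Finite

variable (hO : O.IsLawful)
include hO

/-- In a module in which every vector lies in a finite-dimensional `𝔨`-stable subspace, every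
non-zero vector yields a non-zero `𝔨`-highest-weight vector whose weight is a natural number `n`,
killed by `F_k` if `n = 0` (finite-dimensional `𝔰𝔩₂`-theory: Mathlib's
`IsSl2Triple.exists_hasPrimitiveVectorWith`, `HasPrimitiveVectorWith.exists_nat`,
`pow_toEnd_f_eq_zero_of_eq_nat`). [folklore] -/
theorem exists_isHW_nat
    (hfin : ∀ v : C, ∃ S : Submodule ℂ C, v ∈ S ∧ FiniteDimensional ℂ S ∧
      (∀ x ∈ S, O.Ek x ∈ S) ∧ (∀ x ∈ S, O.Fk x ∈ S) ∧ (∀ x ∈ S, O.Hk x ∈ S))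
    {v : C} (hv : v ≠ 0) :
    ∃ (w : C) (n : ℕ), w ≠ 0 ∧ O.IsHW w n ∧ (n = 0 → O.Fk w = 0) := by
  obtain ⟨S, hvS, hSfin, hES, hFS, hHS⟩ := hfin v
  haveI := hSfin
  set e : Module.End ℂ S := (O.Ek).restrict hES with he
  set f : Module.End ℂ S := (O.Fk).restrict hFS with hf
  set h : Module.End ℂ S := (O.Hk).restrict hHS with hh
  by_cases hh0 : h = 0
  · -- `H_k = 0` on `S`, hence `E_k = F_k = 0` on `S`: `v` itself is highest-weight of weight `0`
    have hH0 : ∀ x ∈ S, O.Hk x = 0 := fun x hx => by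
      have := congrArg (fun T : Module.End ℂ S => ((T ⟨x, hx⟩ : S) : C)) hh0
      simpa [hh] using this
    have hE0 : ∀ x ∈ S, O.Ek x = 0 := fun x hx => by
      have h1 := Hk_Ek hO x
      rw [hH0 x hx, map_zero, hH0 _ (hES x hx), zero_add] at h1
      exact (smul_eq_zero.1 h1.symm).resolve_left two_ne_zero
    have hF0 : ∀ x ∈ S, O.Fk x = 0 := fun x hx => by
      have h1 := Hk_Fk hO x
      rw [hH0 x hx, map_zero, hH0 _ (hFS x hx), zero_sub] at h1
      exact (smul_eq_zero.1 (neg_eq_zero.1 h1.symm)).resolve_left two_ne_zero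
    exact ⟨v, 0, hv, ⟨hE0 v hvS, by rw [hH0 v hvS, Nat.cast_zero, zero_smul]⟩, fun _ => hF0 v hvS⟩
  · -- a genuine `𝔰𝔩₂`-triple on the finite-dimensional `S`
    have t : IsSl2Triple h e f := by
      refine ⟨hh0, ?_, ?_, ?_⟩
      · refine LinearMap.ext fun x => Subtype.ext ?_
        show O.Ek (O.Fk (x : C)) - O.Fk (O.Ek (x : C)) = O.Hk (x : C)
        rw [Ek_Fk hO]
        abel
      · refine LinearMap.ext fun x => Subtype.ext ?_
        show O.Hk (O.Ek (x : C)) - O.Ek (O.Hk (x : C)) = 2 • O.Ek (x : C)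
        rw [Hk_Ek hO, two_smul, two_nsmul]
        abel
      · refine LinearMap.ext fun x => Subtype.ext ?_
        show O.Hk (O.Fk (x : C)) - O.Fk (O.Hk (x : C)) = -(2 • O.Fk (x : C))
        rw [Hk_Fk hO, two_smul, two_nsmul]
        abel
    haveI : Nontrivial S := ⟨⟨⟨v, hvS⟩, 0, fun h0 => hv (congrArg Subtype.val h0)⟩⟩
    obtain ⟨μ, m, hm0, hP⟩ := t.exists_hasPrimitiveVectorWith (R := ℂ) (M := S)
    obtain ⟨n, hn⟩ := hP.exists_nat (R := ℂ)
    refine ⟨(m : C), n, fun h0 => hm0 (Subtype.ext h0), ⟨?_, ?_⟩, fun hn0 => ?_⟩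
    · exact congrArg Subtype.val hP.lie_e
    · have := congrArg Subtype.val hP.lie_h
      rw [hn] at this
      exact this
    · have hf0 := hP.pow_toEnd_f_eq_zero_of_eq_nat hn
      rw [hn0, zero_add, pow_one, LieModule.toEnd_module_end] at hf0
      exact congrArg Subtype.val hf0

end Finite

/-! ### The lowest `K`-type `V_{2p}` -/

section Main

variable {ip : C → C → ℂ} (hip : Kuga.IsPosForm ip) (hO : O.IsLawful)
  (hE : ∀ x y, ip (O.LE x) y = -ip x (O.RE y))
  (hF : ∀ x y, ip (O.LF x) y = -ip x (O.RF y))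
  (hH : ∀ x y, ip (O.LH x) y = -ip x (O.RH y))
  {p : ℕ} (hp : 1 ≤ p)
  (hcL : ∀ v, O.casL v = ((((p : ℝ) ^ 2 - 1) / 2 : ℝ) : ℂ) • v)
  (hcR : ∀ v, O.casR v = ((((p : ℝ) ^ 2 - 1) / 2 : ℝ) : ℂ) • v)
include hip hO hE hF hH hcL hcR

/-- The norm identity for the lowering vector at a natural weight `n ≥ 1`, real form:
`4(n+1) ‖w₋‖² = n (n² − 4p²) ‖w‖²`. [cite: Harder1987, §3.1] -/
theorem re_inner_lower_nat {n : ℕ} (hn1 : 1 ≤ n) {w : C} (hw : O.IsHW w (n : ℂ)) :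
    4 * ((n : ℝ) + 1) * (ip (O.lower w n) (O.lower w n)).re =
      (n : ℝ) * ((n : ℝ) ^ 2 - 4 * (p : ℝ) ^ 2) * (ip w w).re := by
  have hw' : O.IsHW w ((n : ℝ) : ℂ) := by rwa [Complex.ofReal_natCast]
  have hn0 : ((n : ℝ) : ℂ) ≠ 0 := by exact_mod_cast (show (n : ℝ) ≠ 0 by positivity)
  have hn1' : ((n : ℝ) : ℂ) + 1 ≠ 0 := by exact_mod_cast (show (n : ℝ) + 1 ≠ 0 by positivity)
  have hn2 : ((n : ℝ) : ℂ) + 2 ≠ 0 := by exact_mod_cast (show (n : ℝ) + 2 ≠ 0 by positivity)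
  have key := inner_lower_eq hip hO hE hF hH hcL hcR hw' hn0 hn1' hn2
  have hl : O.lower w ((n : ℝ) : ℂ) = O.lower w (n : ℂ) := by rw [Complex.ofReal_natCast]
  rw [hl] at key
  have hre := congrArg Complex.re key
  rw [show (4 : ℂ) * (((n : ℝ) : ℂ) + 1) = ((4 * ((n : ℝ) + 1) : ℝ) : ℂ) by push_cast; ring,
    show (((n : ℝ) : ℂ)) * ((((n : ℝ) : ℂ)) ^ 2 - 8 * ((((p : ℝ) ^ 2 - 1) / 2 : ℝ) : ℂ) - 4) =
      (((n : ℝ) * ((n : ℝ) ^ 2 - 4 * (p : ℝ) ^ 2) : ℝ) : ℂ) by push_cast; ring,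
    Complex.re_ofReal_mul, Complex.re_ofReal_mul] at hre
  exact hre

/-- **No highest-weight vectors of weight `1 ≤ n < 2p`.** [cite: Harder1987, §3.1] -/
theorem eq_zero_of_weight_lt {n : ℕ} (hn1 : 1 ≤ n) (hn : n < 2 * p) {w : C}
    (hw : O.IsHW w (n : ℂ)) : w = 0 := by
  have key := re_inner_lower_nat hip hO hE hF hH hcL hcR hn1 hw
  have hl : 0 ≤ (ip (O.lower w n) (O.lower w n)).re := hip.nonneg _
  have hw0 : 0 ≤ (ip w w).re := hip.nonneg _
  have hneg : (n : ℝ) ^ 2 - 4 * (p : ℝ) ^ 2 < 0 := by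
    have : (n : ℝ) < 2 * p := by exact_mod_cast hn
    have hn0 : (0 : ℝ) ≤ n := by positivity
    nlinarith
  have hnpos : (0 : ℝ) < n := by exact_mod_cast hn1
  -- the right-hand side is `≤ 0`, the left-hand side `≥ 0`
  have hre0 : (ip w w).re = 0 := by
    by_contra hne
    have hpos : 0 < (ip w w).re := lt_of_le_of_ne hw0 (Ne.symm hne)
    have : (n : ℝ) * ((n : ℝ) ^ 2 - 4 * (p : ℝ) ^ 2) * (ip w w).re < 0 :=
      mul_neg_of_neg_of_pos (mul_neg_of_pos_of_neg hnpos hneg) hpos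
    have : 0 ≤ 4 * ((n : ℝ) + 1) * (ip (O.lower w n) (O.lower w n)).re := by positivity
    linarith
  exact hip.eq_zero_of_re_self_eq_zero hre0

include hp in
/-- **Lowering above `2p`**: a non-zero highest-weight vector of weight `n > 2p` yields a non-zero
one of weight `n − 2`. [cite: Harder1987, §3.1] -/
theorem exists_isHW_sub_two {n : ℕ} (hn : 2 * p < n) {w : C} (hw : O.IsHW w (n : ℂ))
    (hw0 : w ≠ 0) : ∃ w' : C, w' ≠ 0 ∧ O.IsHW w' ((n - 2 : ℕ) : ℂ) := by
  have hn1 : 1 ≤ n := by omega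
  have hn2 : 2 ≤ n := by omega
  refine ⟨O.lower w n, fun h0 => ?_, ?_⟩
  · have key := re_inner_lower_nat hip hO hE hF hH hcL hcR hn1 hw
    rw [h0, hip.zero_left, Complex.zero_re, mul_zero] at key
    have hpos : 0 < (n : ℝ) ^ 2 - 4 * (p : ℝ) ^ 2 := by
      have : (2 * p : ℝ) < n := by exact_mod_cast hn
      have hp0 : (0 : ℝ) ≤ p := by positivity
      nlinarith
    have hnpos : (0 : ℝ) < n := by exact_mod_cast hn1
    have hw' : 0 < (ip w w).re :=
      lt_of_le_of_ne (hip.nonneg _) fun h => hw0 (hip.eq_zero_of_re_self_eq_zero h.symm)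
    have : 0 < (n : ℝ) * ((n : ℝ) ^ 2 - 4 * (p : ℝ) ^ 2) * (ip w w).re := by positivity
    linarith
  · have h := isHW_lower hO hw (by exact_mod_cast (show (n : ℝ) ≠ 0 by positivity))
      (by exact_mod_cast (show (n : ℝ) + 1 ≠ 0 by positivity))
    rwa [show (n : ℂ) - 2 = ((n - 2 : ℕ) : ℂ) by push_cast [Nat.cast_sub hn2]; ring] at h

include hp in
/-- **Descent to `2p`**: from a non-zero highest-weight vector of weight `n ≥ 2p` to one of weight
exactly `2p` (the parity `n ≡ 2p (mod 2)` is forced: weight `2p − 1` is excluded).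
[cite: Harder1987, §3.1] -/
theorem exists_isHW_of_ge (d : ℕ) : ∀ {n : ℕ}, n = 2 * p + d → ∀ {w : C}, w ≠ 0 →
    O.IsHW w (n : ℂ) → ∃ w' : C, w' ≠ 0 ∧ O.IsHW w' ((2 * p : ℕ) : ℂ) := by
  induction d using Nat.strong_induction_on with
  | _ d ih =>
    intro n hn w hw0 hw
    rcases Nat.lt_or_ge d 2 with hd | hd
    · interval_cases d
      · exact ⟨w, hw0, by rw [hn, add_zero] at hw; exact hw⟩
      · -- weight `2p + 1`: lowering gives a non-zero vector of the excluded weight `2p - 1`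
        obtain ⟨w', hw'0, hw'⟩ :=
          exists_isHW_sub_two hip hO hE hF hH hp hcL hcR (n := n) (by omega) hw hw0
        have h1 : 1 ≤ n - 2 := by omega
        have h2 : n - 2 < 2 * p := by omega
        exact absurd (eq_zero_of_weight_lt hip hO hE hF hH hcL hcR h1 h2 hw') hw'0
    · obtain ⟨w', hw'0, hw'⟩ :=
        exists_isHW_sub_two hip hO hE hF hH hp hcL hcR (n := n) (by omega) hw hw0
      exact ih (d - 2) (by omega) (by omega) hw'0 hw'

omit hip hO hE hF hH hcL hcR in
/-- A vector killed by `P₊, P₋, P₀, E_k, F_k, H_k` is killed by all six operators. [folklore] -/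
theorem killed_of_killed {v : C} (h1 : O.Pp v = 0) (h2 : O.Pm v = 0) (h3 : O.P0 v = 0)
    (h4 : O.Ek v = 0) (h5 : O.Fk v = 0) (h6 : O.Hk v = 0) :
    O.LE v = 0 ∧ O.LF v = 0 ∧ O.LH v = 0 ∧ O.RE v = 0 ∧ O.RF v = 0 ∧ O.RH v = 0 := by
  simp only [Pp_apply, Pm_apply, P0_apply, Ek_apply, Fk_apply, Hk_apply] at h1 h2 h3 h4 h5 h6
  have two : (2 : ℂ) ≠ 0 := two_ne_zero
  have kill : ∀ {a b : C}, a + b = 0 → a - b = 0 → a = 0 ∧ b = 0 := by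
    intro a b hab hab'
    have ha : (2 : ℂ) • a = 0 := by
      rw [two_smul, show a + a = (a + b) + (a - b) by abel, hab, hab', add_zero]
    have hb : (2 : ℂ) • b = 0 := by
      rw [two_smul, show b + b = (a + b) - (a - b) by abel, hab, hab', sub_zero]
    exact ⟨(smul_eq_zero.1 ha).resolve_left two, (smul_eq_zero.1 hb).resolve_left two⟩
  obtain ⟨hLE, hRF⟩ := kill h1 h4
  obtain ⟨hLF, hRE⟩ := kill h2 h5
  obtain ⟨hLH, hRH⟩ := kill h3 h6
  exact ⟨hLE, hLF, hLH, hRE, hRF, hRH⟩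

include hp in
/-- **The lowest `K`-type.**  Let the six operators satisfy the `𝔰𝔩₂ × 𝔰𝔩₂` relations, with
Casimir scalars `Ω_L = Ω_R = ½(p² − 1)` (`p ≥ 1`), unitarity `L(Z)† = −R(Z̄)` for a positive
definite Hermitian form, `𝔨`-finiteness (every vector in a finite-dimensional `E_k, F_k, H_k`-stable
subspace) and no non-zero vector killed by all six operators (no `SL₂(ℂ)`-invariants: cuspidality).
Then a non-zero module contains a non-zero `𝔨`-highest-weight vector of weight exactly `2p` — the
lowest `U(2)`-type of the unitary principal series `π(2p, 0)` of `GL₂(ℂ)`, i.e. the `K`-type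
`V_{m+n+2} ⊂ 𝔭 ⊗ (Sym^m ⊗ \overline{Sym}^n)^*` (`p = m + 1 = n + 1`) carrying the Eichler–Shimura–Harder
classes. [cite: Harder1987, §3.1 (3.1.3)–(3.1.5)] -/
theorem exists_isHW_two_mul
    (hfin : ∀ v : C, ∃ S : Submodule ℂ C, v ∈ S ∧ FiniteDimensional ℂ S ∧
      (∀ x ∈ S, O.Ek x ∈ S) ∧ (∀ x ∈ S, O.Fk x ∈ S) ∧ (∀ x ∈ S, O.Hk x ∈ S))
    (hnoinv : ∀ v : C, O.LE v = 0 → O.LF v = 0 → O.LH v = 0 → O.RE v = 0 → O.RF v = 0 →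
      O.RH v = 0 → v = 0)
    {v : C} (hv : v ≠ 0) : ∃ w : C, w ≠ 0 ∧ O.IsHW w ((2 * p : ℕ) : ℂ) := by
  -- (1) a highest-weight vector with natural weight
  obtain ⟨w₀, n₀, hw₀0, hw₀, hF₀⟩ := exists_isHW_nat hO hfin hv
  -- (2) one of weight `≥ 1`
  obtain ⟨w₁, n₁, hw₁0, hn₁, hw₁⟩ : ∃ (w : C) (n : ℕ), w ≠ 0 ∧ 1 ≤ n ∧ O.IsHW w (n : ℂ) := by
    rcases Nat.eq_zero_or_pos n₀ with h0 | hpos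
    · subst h0
      by_cases hP : O.Pp w₀ = 0
      · -- `w₀` is killed by everything: excluded
        exfalso
        have hPm : O.Pm w₀ = 0 := by
          have e := inner_Pp_Pp hip hO hE hF hw₀
          rw [hP, hip.zero_left, Nat.cast_zero, zero_mul, add_zero] at e
          exact hip.definite _ e.symm
        have hP0 : O.P0 w₀ = 0 := by
          rw [P0_eq hip hO hE hF hH hcL hcR hw₀ (by norm_num), hP, map_zero, smul_zero, neg_zero]
        have hHk : O.Hk w₀ = 0 := by rw [hw₀.hk, Nat.cast_zero, zero_smul]
        obtain ⟨h1, h2, h3, h4, h5, h6⟩ := killed_of_killed hP hPm hP0 hw₀.ek (hF₀ rfl) hHk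
        exact hw₀0 (hnoinv w₀ h1 h2 h3 h4 h5 h6)
      · refine ⟨O.Pp w₀, 2, hP, by norm_num, ?_⟩
        have h := isHW_Pp hO hw₀
        rwa [Nat.cast_zero, zero_add, show (2 : ℂ) = ((2 : ℕ) : ℂ) by norm_num] at h
    · exact ⟨w₀, n₀, hw₀0, hpos, hw₀⟩
  -- (3) its weight is `≥ 2p`
  have hge : 2 * p ≤ n₁ := by
    by_contra hlt
    exact hw₁0 (eq_zero_of_weight_lt hip hO hE hF hH hcL hcR hn₁ (by omega) hw₁)
  -- (4) descend to `2p`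
  exact exists_isHW_of_ge hip hO hE hF hH hp hcL hcR (n₁ - 2 * p) (by omega) hw₁0 hw₁

omit hcL hcR in
/-- **Harder's vanishing**: if the Casimir scalars differ (`c_L ≠ c_R`, both real) and every vector
lies in a finite-dimensional `𝔨`-stable subspace, the module is zero. [cite: Harder1987, §3.2] -/
theorem eq_zero_of_casimir_ne' {cL cR : ℝ} (hne : cL ≠ cR) (hcL : ∀ v, O.casL v = (cL : ℂ) • v)
    (hcR : ∀ v, O.casR v = (cR : ℂ) • v)
    (hfin : ∀ v : C, ∃ S : Submodule ℂ C, v ∈ S ∧ FiniteDimensional ℂ S ∧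
      (∀ x ∈ S, O.Ek x ∈ S) ∧ (∀ x ∈ S, O.Fk x ∈ S) ∧ (∀ x ∈ S, O.Hk x ∈ S))
    (v : C) : v = 0 := by
  by_contra hv
  obtain ⟨w, n, hw0, hw, -⟩ := exists_isHW_nat hO hfin hv
  have hw' : O.IsHW w ((n : ℝ) : ℂ) := by rwa [Complex.ofReal_natCast]
  exact hw0 (eq_zero_of_casimir_ne hip hO hE hF hH hne hcL hcR hw')

end Main

end Ops

end GL2CKType

end Literature.NumberTheory.Automorphic

end
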